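import Summits.BirchSwinnertonDyer.BirchSwinnertonDyer.Theorems.AlignedTransportAtTwoMainConjectureOfRankZeroBSDAtTwoSelmerLayerMuDoor
import Summits.BirchSwinnertonDyer.BirchSwinnertonDyer.Theorems.PublishedInputsGreenbergLemma34AllLayers
import Literature.NumberTheory.EllipticCurves.IwasawaSelmerControlOfLayerKernelsProofs
import HarnessLib

/-!
# Route `AlignedTransportAtTwo`, crux C2 `MainConjectureOfRankZeroBSDAtTwo` (stmt-BirchSwinnertonDyer-22298):
# THE SELMER RANK-JUMP `μ`-DOOR IS COMPLETE — over `ℚ` at a good ordinary `p` (and at the cell's `p = 2`),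
# `X` torsion ∧ `μ(X) = 0` ⟺ the two-layer inequality holds at SOME pair of layers: stub T per curve is a Σ₁ statement

HONEST FRAMING (cell `bsd-f1-sign2`, WIDTH-5 attached prover seat `bsd-line-att-p5` gen 43 on line `birth` of the lead
`bsd-line-att-p2`; `--supports` stmt-BirchSwinnertonDyer-22298, closes nothing; BSD is NOT proved by any of this; the crux
C2, its verdict «blocked-on `Rank1Residual.GreenbergMuConjectureIrreducible`» and every registered stub are untouched).
THEOREMS ONLY — no `def`, no instance, no named fact, no `sorry`. Sequel of `…SelmerLayerMuDoor` (the door: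
`#Sel_k[p]·#ker g_k·p^{p^j} < #Sel_j[p]·p^{p^k}` at one pair `j < k` ⟹ `X` torsion, `μ(X) = 0`). Here the CONVERSE:

* §1 (any number field `K`, any `ℤ_p`-extension with topological generator, any dual datum with `X` finitely generated)
  ★★ `exists_selmer_rankJump_of_mu_eq_zero` — if `E(K_∞)[p^∞] = 0`, `#ker g_n ≤ B` for all `n` (Greenberg's Lemma 3.5), `X` is torsion and
  `μ(X) = 0`, then the inequality holds at some pair `j < k`: `X/pX` is finite (`IwasawaModuleRankJump`), so `#X/(ω_n,p)X = c` is constant for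
  `n ≫ 0`, whence `#Sel_n[p] ≤ c ≤ #Sel_n[p]·B` by the sandwich, and `c·B·p^{p^j} ≤ #Sel_j[p]·B²·p^{p^j} < #Sel_j[p]·p^{p^k}` for `k` large.
* §2 over `ℚ`: ★★★ `isTorsion_and_mu_eq_zero_iff_exists_selmer_rankJump_rat` — for `W/ℚ` globally minimal good ordinary at `p` with
  `E(ℚ_∞)[p^∞] = 0`, `κ` cyclotomic: **`X` torsion ∧ `μ(X) = 0` ⟺ ∃ `j < k`, `#Sel_k[p]·#ker g_k·p^{p^j} < #Sel_j[p]·p^{p^k}`** (Lemma 3.5 over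
  `ℚ` is a theorem: `Greenberg1999_kerG_bounded_of_lemma34` + seat `bsd-inputs-k4-p1`'s `lemma34_natCard_localTowerKerPrimary_eq_rat_holds`);
  ★★★★ `seedMuZero_iff_exists_selmer_rankJump_two` — **for every `W/ℚ` good ordinary at `2` without rational `2`-torsion, cyclotomic `κ`,
  topological generator `γ`, dual datum `D`: `(D.IsTorsion ∧ D.mu = 0)` ⟺ ∃ `j < k`, `#Sel_k[2]·#ker g_k·2^{2^j} < #Sel_j[2]·2^{2^k}`** — the
  content of the OPEN stub T `SeedMuZeroAtTwo` at `(W, κ, γ, D)` is EQUIVALENT to a Σ₁ (existential, descent-checkable) statement.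

References: R. Greenberg, LNM 1716 (1999), §1 Conj. 1.11, pp. 60–62, §3 Lemmas 3.1–3.5, §4 Lemma 4.3 [GreenbergLNM1716]; L. Washington,
GTM 83, §13.3 Prop. 13.22–13.23 [Washington1997]; T. Fukuda, Proc. Japan Acad. 70 (1994) Thm. 1 [Fukuda1994].
-/

set_option linter.dupNamespace false
set_option autoImplicit false

noncomputable section

open scoped Classical AddSubgroup

universe u

namespace Summit.BirchSwinnertonDyer.BirchSwinnertonDyer.Theorems.AlignedTransportAtTwoSelmerLayerMuDoorComplete

open WeierstrassCurve Literature.NumberTheory.EllipticCurves Literature.NumberTheory.EllipticCurves.IwasawaDual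
  Literature.NumberTheory.EllipticCurves.IwasawaAlgebra Literature.NumberTheory.IwasawaTheory.IwasawaModuleRankJump
  Literature.NumberTheory.EllipticCurves.Greenberg1999
  Summit.BirchSwinnertonDyer.BirchSwinnertonDyer.Theorems.AlignedTransportAtTwoSelmerLayerModel
  Summit.BirchSwinnertonDyer.BirchSwinnertonDyer.Theorems.AlignedTransportAtTwoSelmerLayerDuality
  Summit.BirchSwinnertonDyer.BirchSwinnertonDyer.Theorems.AlignedTransportAtTwoSelmerLayerMuDoorCount
  Summit.BirchSwinnertonDyer.BirchSwinnertonDyer.Theorems.AlignedTransportAtTwoSelmerLayerMuDoor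
  Summit.BirchSwinnertonDyer.BirchSwinnertonDyer.Theorems.AlignedTransportAtTwoSelmerLayerAllPrimes

/-! ## §1 The converse over any number field, modulo boundedness of `#ker g_n` -/

section Converse

variable {K : Type u} [Field K] [NumberField K] (W : WeierstrassCurve K) {p : ℕ} [hp : Fact p.Prime]
  (κ : ZpExtension K p) {γ : Field.absoluteGaloisGroup K}

/-- ★★ **`X` torsion with `μ(X) = 0` ⟹ the Selmer rank-jump door opens at some pair `j < k`**, for any number field, any `ℤ_p`-extension
with topological generator `γ`, any dual datum with `X` finitely generated, provided `E(K_∞)[p^∞] = 0` and `#ker g_n ≤ B` for every `n`.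
[cite: GreenbergLNM1716, §1 pp. 60–62 and §3 Lemma 3.5] [cite: Washington1997, §13.3 Prop. 13.23] -/
theorem exists_selmer_rankJump_of_mu_eq_zero (hγ : κ.IsTopGenerator γ) (D : W.SelmerDualData κ γ)
    [Module.Finite (IwasawaAlgebra p) D.X]
    (hB : FixedPoints.addSubgroup κ.kerSubgroup (W.geomPrimaryTorsion p) = ⊥)
    (hbd : ∃ B : ℕ, ∀ n : ℕ, Finite (W.KerG κ n) ∧ Nat.card (W.KerG κ n) ≤ B)
    (hT : D.IsTorsion) (hμ : D.mu = 0) :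
    ∃ j k : ℕ, j < k ∧
      Nat.card ((↥(W.selmerLayer κ k))[(p : ℤ)]) * Nat.card (W.KerG κ k) * p ^ (p ^ j) <
        Nat.card ((↥(W.selmerLayer κ j))[(p : ℤ)]) * p ^ (p ^ k) := by
  have hpr : p.Prime := hp.out
  obtain ⟨B, hBd⟩ := hbd
  -- `X/pX` is finite and `#X/(ω_n, p)X = c` for `n ≥ n₀`
  haveI hfin : Finite (D.X ⧸ augIdealP p • (⊤ : Submodule (IwasawaAlgebra p) D.X)) :=
    finite_quotient_augIdealP_of_muInvariant_eq_zero hT hμ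
  obtain ⟨n₀, hn₀⟩ := exists_forall_smul_top_eq_of_finite_quotient_augIdealP hfin
  set c := Nat.card (D.X ⧸ augIdealP p • (⊤ : Submodule (IwasawaAlgebra p) D.X)) with hc
  have hQ : ∀ n : ℕ, n₀ ≤ n →
      Nat.card (D.X ⧸ (Ideal.span {((1 + PowerSeries.X : PowerSeries ℤ_[p]) ^ (p ^ n) - 1 : IwasawaAlgebra p)} ⊔
        augIdealP p) • (⊤ : Submodule (IwasawaAlgebra p) D.X)) = c := by
    intro n hn
    rw [omega_smul_top_eq, hn₀ (p ^ n) (hn.trans (Nat.lt_pow_self hpr.one_lt).le)]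
  -- the pair of layers
  set j := n₀ with hj
  set k := j + B ^ 2 * p ^ (p ^ j) + 1 with hk
  have hjk : j < k := by omega
  have hpow : B ^ 2 * p ^ (p ^ j) < p ^ (p ^ k) :=
    calc B ^ 2 * p ^ (p ^ j) < k := by omega
      _ < p ^ k := Nat.lt_pow_self hpr.one_lt
      _ < p ^ (p ^ k) := Nat.pow_lt_pow_right hpr.one_lt (Nat.lt_pow_self hpr.one_lt)
  refine ⟨j, k, hjk, ?_⟩
  -- the sandwich at `j` and `k`
  haveI := finite_torsionBy_selmerInvariants p W κ hγ D j
  haveI := finite_torsionBy_selmerInvariants p W κ hγ D k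
  haveI := (hBd j).1
  haveI := (hBd k).1
  have hinjj := layerToInfty_injective_of_fixedPoints_eq_bot W κ hγ hB j
  have hinjk := layerToInfty_injective_of_fixedPoints_eq_bot W κ hγ hB k
  haveI := (natCard_torsionBy_selmerLayer_le W κ j hinjj).1
  have hSk : Nat.card ((↥(W.selmerLayer κ k))[(p : ℤ)]) ≤ c := by
    rw [← hQ k hjk.le, natCard_layerQuotientP_eq_natCard_torsionBy_selmerInvariants p W κ hγ D k]
    exact (natCard_torsionBy_selmerLayer_le W κ k hinjk).2
  have hSj : c ≤ Nat.card ((↥(W.selmerLayer κ j))[(p : ℤ)]) * B := by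
    rw [← hQ j le_rfl, natCard_layerQuotientP_eq_natCard_torsionBy_selmerInvariants p W κ hγ D j]
    exact (natCard_torsionBy_selmerInvariants_le W κ j hinjj).trans (Nat.mul_le_mul_left _ (hBd j).2)
  have hpos : 0 < Nat.card ((↥(W.selmerLayer κ j))[(p : ℤ)]) := Nat.card_pos
  calc Nat.card ((↥(W.selmerLayer κ k))[(p : ℤ)]) * Nat.card (W.KerG κ k) * p ^ (p ^ j)
      ≤ c * B * p ^ (p ^ j) := Nat.mul_le_mul_right _ (Nat.mul_le_mul hSk (hBd k).2)
    _ ≤ Nat.card ((↥(W.selmerLayer κ j))[(p : ℤ)]) * B * B * p ^ (p ^ j) := by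
        gcongr
    _ = Nat.card ((↥(W.selmerLayer κ j))[(p : ℤ)]) * (B ^ 2 * p ^ (p ^ j)) := by ring
    _ < Nat.card ((↥(W.selmerLayer κ j))[(p : ℤ)]) * p ^ (p ^ k) := Nat.mul_lt_mul_of_pos_left hpow hpos

end Converse

/-! ## §2 Over `ℚ`: the door is an EQUIVALENCE -/

section Rat

open Summit.BirchSwinnertonDyer.BirchSwinnertonDyer.Theorems.InputsGreenbergLemma34Layer

variable (W : WeierstrassCurve ℚ) [W.IsElliptic] [W.IsGloballyMinimal] {p : ℕ} [hp : Fact p.Prime]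
  (κ : ZpExtension ℚ p) {γ : Field.absoluteGaloisGroup ℚ}

/-- ★★★ **Over `ℚ` at a good ordinary `p` with `E(ℚ_∞)[p^∞] = 0` (`κ` cyclotomic, `γ` a topological generator, ANY dual datum `D`):
`X` torsion ∧ `μ(X) = 0` ⟺ ∃ `j < k`, `#Sel_k[p]·#ker g_k·p^{p^j} < #Sel_j[p]·p^{p^k}`.** ⟸ is the door; ⟹ uses Greenberg's Lemma 3.5
over `ℚ` (a theorem: `Greenberg1999_kerG_bounded_of_lemma34` fed by `lemma34_natCard_localTowerKerPrimary_eq_rat_holds`).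
[cite: GreenbergLNM1716, §1 Conj. 1.11, pp. 60–62; §3 Lemmas 3.4–3.5] [cite: Washington1997, §13.3 Prop. 13.23] [cite: Fukuda1994, Thm. 1] -/
theorem isTorsion_and_mu_eq_zero_iff_exists_selmer_rankJump_rat (hord : IsOrdinaryAt W p)
    (hB : FixedPoints.addSubgroup κ.kerSubgroup (W.geomPrimaryTorsion p) = ⊥) (hκ : κ.IsCyclotomic)
    (hγ : κ.IsTopGenerator γ) (D : W.SelmerDualData κ γ) :
    (D.IsTorsion ∧ D.mu = 0) ↔ ∃ j k : ℕ, j < k ∧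
      Nat.card ((↥(W.selmerLayer κ k))[(p : ℤ)]) * Nat.card (W.KerG κ k) * p ^ (p ^ j) <
        Nat.card ((↥(W.selmerLayer κ j))[(p : ℤ)]) * p ^ (p ^ k) := by
  haveI : Module.Finite (IwasawaAlgebra p) D.X := SelmerDualData.module_finite_of_isCyclotomic W κ hκ D hγ
  constructor
  · rintro ⟨hT, hμ⟩
    have hgo : W.HasGoodReductionAtPrime p ∧ ¬ ((p : ℕ) : ℤ) ∣ W.frobeniusTrace p := hord
    have hbd := (W.Greenberg1999_kerG_bounded_of_lemma34 κ lemma34_natCard_localTowerKerPrimary_eq_rat_holds) hκ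
      (W.hasGoodReductionAt_and_hasUnitRootAt_of_rat hgo.1 hgo.2)
    exact exists_selmer_rankJump_of_mu_eq_zero W κ hγ D hB hbd hT hμ
  · rintro ⟨j, k, hjk, hlt⟩
    have h := isTorsion_and_mu_eq_zero_of_selmer_rankJump_rat W κ hord hB hκ hγ D hjk hlt
    exact ⟨h.1, h.2.1⟩

/-- ★★★★ **STUB T IS Σ₁ PER CURVE.** For every `W/ℚ` (globally minimal, elliptic) good ordinary at `2` WITHOUT a rational point of order `2`,
the cyclotomic `ℤ₂`-extension `κ` with topological generator `γ`, and ANY dual datum `D`: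
**`(D.IsTorsion ∧ D.mu = 0)` ⟺ there are layers `j < k` with `#Sel_k[2]·#ker g_k·2^{2^j} < #Sel_j[2]·2^{2^k}`**
(`Sel_n = W.selmerLayer κ n ≃ Sel_{2^∞}(E_{ℚ_n}/ℚ_n)`, `ker g_n = W.KerG κ n`, Greenberg's finite local defect). The registered OPEN
stub `SeedMuZeroAtTwo` asserts the left side (in the form `D.IsTorsion → D.mu = 0`, `D.IsTorsion` being PRINT on the cell by Kato) for
every seed; the right side is, curve by curve, a statement CERTIFIED by finitely many `2`-descents when true. Nothing here proves T for
any curve. [cite: GreenbergLNM1716, §1 Conj. 1.11; §3 Lemmas 3.1–3.5] [cite: Washington1997, §13.3 Prop. 13.23] [cite: Fukuda1994, Thm. 1] -/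
theorem seedMuZero_iff_exists_selmer_rankJump_two (hord : IsOrdinaryAt W 2) (ht : ∀ x : ℚ, ¬ HasRationalTwoTorsionX W x)
    (κ : ZpExtension ℚ 2) (hκ : κ.IsCyclotomic) {γ : Field.absoluteGaloisGroup ℚ} (hγ : κ.IsTopGenerator γ)
    (D : W.SelmerDualData κ γ) :
    (D.IsTorsion ∧ D.mu = 0) ↔ ∃ j k : ℕ, j < k ∧
      Nat.card ((↥(W.selmerLayer κ k))[(2 : ℤ)]) * Nat.card (W.KerG κ k) * 2 ^ (2 ^ j) <
        Nat.card ((↥(W.selmerLayer κ j))[(2 : ℤ)]) * 2 ^ (2 ^ k) := by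
  have h := isTorsion_and_mu_eq_zero_iff_exists_selmer_rankJump_rat W κ hord (fixedPoints_eq_bot_two W κ hκ ht) hκ hγ D
  exact_mod_cast h

end Rat

end Summit.BirchSwinnertonDyer.BirchSwinnertonDyer.Theorems.AlignedTransportAtTwoSelmerLayerMuDoorComplete

end
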